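import Mathlib.Analysis.Complex.Liouville
import HarnessLib

/-!
# NE7, ROAD P4 (law-level): NODE Q.old, item (k12) — the COMPOSITION STEP (QL-d) of `REDUCTION-QL-NE7-P4.md`:
# per-piece Cauchy estimates along one complexified bond rotation, summed

(Cell `pub-balaban`, sub-cell `t4`, binder row NE7 = node U5, co-owner #4 `b2b-balaban-t4-ne7-p4`, gen 3; skeleton
`HOME/t4/skeletons/NE7-t4-ne7-p4.md` v1.9 §2 NODE Q.old leaf (QL); reduction file
`HOME/t4/b2b-balaban-t4-ne7-p4/g3/REDUCTION-QL-NE7-P4.md` v1 §2 (QL-a)–(QL-d); GAPS G-ne7p4-4 (UPDATE v1.9).)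

HONEST FRAMING (T4-DAG PAGE 1).  Rung (B)+1 on ONE FIXED finite four-torus, CONDITIONAL on `BetaPertH` and the nine
spine estimates (0/9 proved); NOT infinite volume, NOT a mass gap, NOT the Clay problem.  NE7 is NOT PRINTED and NOT
proved here.  This file is [folklore] one-variable complex analysis (Mathlib's Cauchy estimate
`Complex.norm_deriv_le_of_forall_mem_sphere_norm_le`) plus finite sums; it asserts NOTHING about Bałaban's objects;
NOT summit progress.

WHAT THIS FILE DOES.  In `REDUCTION-QL` the Lipschitz constant of the posterior kick functional `φ_Z^{(j)}` in one
coarse bond variable is the derivative at `t = 0` of `t ↦ φ_Z^{(j)}(W_t)` along the bond rotation `W_t = e^{itB′}W`,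
and `φ_Z^{(j)} = Σ_p Φ_p` over pieces `p = (i, X)` (scale, localisation domain).  The three inputs (QL-a) (scale-resolved
effective-observable type: analyticity with sup bound `s_p`), (QL-b) (minimiser response) and (QL-c) (regular gauge,
[Balaban 1985, CMP 99:75] Thm 2) combine, per piece, into: «along the complexified rotation, `t ↦ Φ_p(W_t)` extends to
a function `F p` complex-differentiable on the closed disc of radius `c / a_p` and bounded there by `s_p`», where
`a_p` is the response size of (QL-b)+(QL-c) and `c = c(α₀, α₁)` the fraction of the complex space's radii.  That
combined statement is the hypothesis SHAPE `AnalyticPiecesAlongRotation` below (DICTIONARY only — nothing of it is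
proved here); the theorems are the step (QL-d):
* `norm_deriv_le_of_piece` — ONE PIECE: `‖(F p)′(0)‖ ≤ s_p · a_p / c` (Cauchy's estimate on the disc of radius c/a_p);
* `sum_norm_deriv_le` — SUMMED: `Σ_p ‖(F p)′(0)‖ ≤ (Σ_p s_p a_p) / c`;
* `norm_deriv_sum_le` — the derivative of the sum: `‖(Σ_p F p)′(0)‖ ≤ (Σ_p s_p a_p) / c`.
With the skeleton's profile `s_p a_p ≲ s_Z L^{−2j}·(weights)` this is `ℓ_{Z,j} ≤ C_QL s_Z L^{−2j}(1 + c′gj)` — arithmetic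
left to the instantiation.
-/

noncomputable section

open Metric Finset Complex
open scoped BigOperators

namespace Summit.QuantumFields.BalabanUV.T4Continuum.NE7LawLevel

variable {P : Type*}

/-- **(QL-a)∧(QL-b)∧(QL-c) ALONG ONE BOND ROTATION, AS A HYPOTHESIS SHAPE (NOT PRINTED, NOT proved).**
For every piece `p ∈ pieces`: a response size `a p > 0`, a sup size `s p ≥ 0`, and a function `F p : ℂ → ℂ`
(DICTIONARY: `t ↦ Φ_p(e^{iηA′_t}U_{k+j}(W))`, the piece evaluated along the re-gauged complexified rotation) which is
complex-differentiable on the closed disc of radius `c / a p` around `0` and bounded by `s p` there; `c > 0`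
(DICTIONARY: the fraction `c(α₀, α₁)` of the radii of the complex space `U^c_i(X, α₀, α₁)`). [folklore] -/
def AnalyticPiecesAlongRotation (pieces : Finset P) (F : P → ℂ → ℂ) (s a : P → ℝ) (c : ℝ) : Prop :=
  0 < c ∧ ∀ p ∈ pieces, 0 < a p ∧ 0 ≤ s p ∧ DifferentiableOn ℂ (F p) (closedBall 0 (c / a p)) ∧
    ∀ z ∈ closedBall (0 : ℂ) (c / a p), ‖F p z‖ ≤ s p

/-- **ONE PIECE (Cauchy's estimate).**  If `F` is complex-differentiable on the closed disc of radius `c / a` (`a, c > 0`)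
and bounded there by `s`, then `‖F′(0)‖ ≤ s · a / c`. [folklore] -/
theorem norm_deriv_le_of_piece {F : ℂ → ℂ} {s a c : ℝ} (ha : 0 < a) (hc : 0 < c)
    (hF : DifferentiableOn ℂ F (closedBall 0 (c / a))) (hb : ∀ z ∈ closedBall (0 : ℂ) (c / a), ‖F z‖ ≤ s) :
    ‖deriv F 0‖ ≤ s * a / c := by
  have hR : 0 < c / a := div_pos hc ha
  have hd : DiffContOnCl ℂ F (ball 0 (c / a)) := hF.diffContOnCl_ball subset_rfl
  have hsph : ∀ z ∈ sphere (0 : ℂ) (c / a), ‖F z‖ ≤ s := fun z hz => hb z (sphere_subset_closedBall hz)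
  have h := norm_deriv_le_of_forall_mem_sphere_norm_le hR hd hsph
  calc ‖deriv F 0‖ ≤ s / (c / a) := h
    _ = s * a / c := by rw [div_div_eq_mul_div]

/-- **SUMMED OVER THE PIECES**: `Σ_p ‖(F p)′(0)‖ ≤ (Σ_p s_p·a_p) / c`. [folklore] -/
theorem sum_norm_deriv_le {pieces : Finset P} {F : P → ℂ → ℂ} {s a : P → ℝ} {c : ℝ}
    (h : AnalyticPiecesAlongRotation pieces F s a c) :
    ∑ p ∈ pieces, ‖deriv (F p) 0‖ ≤ (∑ p ∈ pieces, s p * a p) / c := by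
  obtain ⟨hc, hp⟩ := h
  rw [sum_div]
  refine sum_le_sum fun p hpp => ?_
  obtain ⟨ha, -, hF, hb⟩ := hp p hpp
  exact norm_deriv_le_of_piece ha hc hF hb

/-- Each piece is differentiable at `0` (the centre of its closed disc). [folklore] -/
theorem differentiableAt_of_piece {F : ℂ → ℂ} {a c : ℝ} (ha : 0 < a) (hc : 0 < c)
    (hF : DifferentiableOn ℂ F (closedBall 0 (c / a))) : DifferentiableAt ℂ F 0 :=
  hF.differentiableAt (closedBall_mem_nhds _ (div_pos hc ha))

/-- **THE DERIVATIVE OF THE SUM** (the Lipschitz constant of `φ_Z^{(j)} = Σ_p Φ_p` in the bond variable, at one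
background): `‖(Σ_p F p)′(0)‖ ≤ (Σ_p s_p·a_p) / c`. [folklore] -/
theorem norm_deriv_sum_le {pieces : Finset P} {F : P → ℂ → ℂ} {s a : P → ℝ} {c : ℝ}
    (h : AnalyticPiecesAlongRotation pieces F s a c) :
    ‖deriv (fun t => ∑ p ∈ pieces, F p t) 0‖ ≤ (∑ p ∈ pieces, s p * a p) / c := by
  have hdiff : ∀ p ∈ pieces, DifferentiableAt ℂ (F p) 0 := fun p hp =>
    differentiableAt_of_piece (h.2 p hp).1 h.1 (h.2 p hp).2.2.1
  have hderiv : deriv (fun t => ∑ p ∈ pieces, F p t) 0 = ∑ p ∈ pieces, deriv (F p) 0 := by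
    have := (HasDerivAt.fun_sum (u := pieces) (A := fun p => F p) (A' := fun p => deriv (F p) 0) (x := (0 : ℂ))
      fun p hp => (hdiff p hp).hasDerivAt)
    exact this.deriv
  rw [hderiv]
  exact (norm_sum_le _ _).trans (sum_norm_deriv_le h)

end Summit.QuantumFields.BalabanUV.T4Continuum.NE7LawLevel

end
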